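import Literature.RepresentationTheory.FiniteGroups.RealCharacters
import Literature.RepresentationTheory.FiniteGroups.RepresentationRing
import Literature.RepresentationTheory.FiniteGroups.NonabelianCharDegree
import HarnessLib

/-!
# `[χψ, ϑ] ≤ ϑ(1)` for irreducible `χ, ψ, ϑ` (Isaacs, *Character Theory of Finite Groups*,
# Problem 4.12)

Topic `Literature/RepresentationTheory/FiniteGroups`, namespace
`Literature.RepresentationTheory.FiniteGroups` (lane `lit-hodgefound`, prover p38, row g15-#6;
uses `RepresentationRing` (products of characters are characters, Thm. 4.1 / Cor. 4.2;
`[φ, χ] ∈ ℕ`), `RealCharacters` (`χ̄` is a character) and `IrreducibleCharacters` (decomposition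
into irreducible constituents with multiplicities)).  Everything here is **proved**; no
definition, no named fact.

Source, verbatim.  I. M. Isaacs, *Character Theory of Finite Groups*, Academic Press 1976 (held
`book:isaacsnd-character-theory-finite-groups`, p. 61 = p0062 L5; Problems to Chapter 4):

> "(4.12) Let `χ, ψ, ϑ ∈ Irr(G)`. Show that `[χψ, ϑ] ≤ ϑ(1)`."

The solution formalised.  `[χψ, ϑ] = [χ, ψ̄ϑ]` (`classInner_mul_left_eq_classInner_star_mul`:
`|G|⁻¹ Σ χψ ϑ̄` read either way, using `ψ(g⁻¹) = \overline{ψ(g)}`), and the multiplicity `a` of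
the irreducible `χ` in the character `ψ̄ϑ` satisfies `a χ(1) ≤ (ψ̄ϑ)(1) = ψ(1)ϑ(1)`
(`IsCharacter.classInner_mul_apply_one_le`); symmetrically `a ψ(1) ≤ χ(1)ϑ(1)`.  Whichever of
`χ(1)`, `ψ(1)` is larger gives `a ≤ ϑ(1)` (**`classInner_mul_le_apply_one`**, stated for `χ, ψ`
irreducible and `ϑ` any character, which contains the printed case
`IsIrrChar.re_classInner_mul_le_re_apply_one`).

## Mathlib / tree search

Mathlib: `Multiset.filter_eq'`, `Multiset.filter_add_not`, `Multiset.sum_replicate`,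
`Complex.conj_natCast`; nothing on multiplicities in products of characters (`lean search
'classInner_mul_le|tensor.*multiplicity.*le|\[χψ'` over Mathlib + Literature/RepresentationTheory:
no hit).  Tree, consumed by name: `IsCharacter.mul` , `IsCharacter.classInner_natCast`
(`RepresentationRing`), `IsCharacter.star` (`RealCharacters`), `IsCharacter.apply_inv_eq_conj`
(`CharacterCentre`), `IsCharacter.exists_multiset_irrChars`, `classInner_multiset_sum_irrChars`,
`multiset_sum_apply`, `classInner_apply` (`IrreducibleCharacters`, `InducedClassFunction`),
`IsIrrChar.isCharacter`, `IsIrrChar.exists_apply_one`, `pos_of_mem_charDegrees`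
(`BrauerInduction`, `CharacterDegrees`, `NonabelianCharDegree`).

## References

* I. M. Isaacs, *Character Theory of Finite Groups*, Academic Press 1976, Problem 4.12 (with
  Thm. 4.1 and Lemma 2.15 (d)) (`Isaacs1976`).
-/

noncomputable section

open scoped BigOperators ComplexConjugate

namespace Literature.RepresentationTheory.FiniteGroups

variable {G : Type} [Group G] [Fintype G]

/-! ## §1 `[χψ, ϑ] = [χ, ψ̄ϑ]` and the multiplicity bound `[φ, χ] χ(1) ≤ φ(1)` -/

/-- `[χψ, ϑ] = [χ, ψ̄ϑ]` for a character `ψ` (both are `|G|⁻¹ Σ_g χ(g)ψ(g)ϑ(g⁻¹)`, as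
`ψ̄(g⁻¹) = ψ(g)` by Lemma 2.15 (d)). [cite: Isaacs1976, Problem 4.12] -/
theorem classInner_mul_left_eq_classInner_star_mul (χ : G → ℂ) {ψ : G → ℂ} (hψ : IsCharacter G ψ)
    (ϑ : G → ℂ) : classInner (χ * ψ) ϑ = classInner χ (star ψ * ϑ) := by
  rw [classInner_apply, classInner_apply]
  congr 1
  refine Finset.sum_congr rfl fun g _ => ?_
  rw [Pi.mul_apply, Pi.mul_apply, Pi.star_apply, hψ.apply_inv_eq_conj, Complex.star_def,
    Complex.conj_conj]
  ring

/-- **The multiplicity of an irreducible constituent is at most `φ(1)/χ(1)`**: for a character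
`φ` and `χ ∈ Irr(G)`, `[φ, χ] χ(1) ≤ φ(1)` (`φ = Σ n_i χ_i`, `φ(1) = Σ n_i χ_i(1) ≥ n_χ χ(1)`);
with the natural numbers `[φ, χ] = a`, `χ(1) = d`, `φ(1) = e` made explicit.
[cite: Isaacs1976, Problem 4.12] -/
theorem IsCharacter.classInner_mul_apply_one_le {φ χ : G → ℂ} (hφ : IsCharacter G φ)
    (hχ : IsIrrChar G χ) :
    ∃ a d e : ℕ, classInner φ χ = a ∧ χ 1 = d ∧ φ 1 = e ∧ a * d ≤ e := by
  classical
  obtain ⟨m, hm, rfl⟩ := hφ.exists_multiset_irrChars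
  obtain ⟨d, -, hd⟩ := hχ.exists_apply_one
  -- degrees of the constituents
  have hdeg : ∀ ψ ∈ m, ∃ n : ℕ, ψ 1 = n := fun ψ hψ => by
    obtain ⟨n, -, hn⟩ := (hm ψ hψ).exists_apply_one
    exact ⟨n, hn⟩
  choose! deg hdeg using hdeg
  refine ⟨m.count χ, d, (m.map deg).sum, classInner_multiset_sum_irrChars hm hχ, hd, ?_, ?_⟩
  · rw [multiset_sum_apply, Nat.cast_multiset_sum, Multiset.map_map]
    congr 1
    exact Multiset.map_congr rfl fun ψ hψ => hdeg ψ hψ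
  · -- split `m` into the copies of `χ` and the rest
    have hsplit := Multiset.filter_add_not (· = χ) m
    rw [Multiset.filter_eq'] at hsplit
    have hdχ : deg χ = d ∨ m.count χ = 0 := by
      by_cases hχm : χ ∈ m
      · left
        have h := hdeg χ hχm
        rw [hd] at h
        exact_mod_cast h.symm
      · right; exact Multiset.count_eq_zero.mpr hχm
    rcases hdχ with hdχ | h0
    · calc m.count χ * d = (Multiset.replicate (m.count χ) χ |>.map deg).sum := by
            rw [Multiset.map_replicate, Multiset.sum_replicate, smul_eq_mul, hdχ]
        _ ≤ (Multiset.replicate (m.count χ) χ |>.map deg).sum +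
              ((m.filter fun ψ => ¬ ψ = χ).map deg).sum := Nat.le_add_right _ _
        _ = (m.map deg).sum := by
            rw [← Multiset.sum_add, ← Multiset.map_add, hsplit]
    · rw [h0, zero_mul]; exact Nat.zero_le _

/-! ## §2 Problem 4.12 -/

/-- **Isaacs, Problem 4.12** (with `ϑ` an arbitrary character): for `χ, ψ ∈ Irr(G)` and a
character `ϑ`, `[χψ, ϑ] ≤ ϑ(1)`; with the natural numbers `[χψ, ϑ] = a`, `ϑ(1) = t` explicit.
Proof: `a = [χ, ψ̄ϑ]` gives `a χ(1) ≤ ψ(1)ϑ(1)`, `a = [ψ, χ̄ϑ]` gives `a ψ(1) ≤ χ(1)ϑ(1)`; use the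
one with the larger of `χ(1)`, `ψ(1)`. [cite: Isaacs1976, Problem 4.12] -/
theorem classInner_mul_le_apply_one {χ ψ ϑ : G → ℂ} (hχ : IsIrrChar G χ) (hψ : IsIrrChar G ψ)
    (hϑ : IsCharacter G ϑ) : ∃ a t : ℕ, classInner (χ * ψ) ϑ = a ∧ ϑ 1 = t ∧ a ≤ t := by
  -- the two bounds
  obtain ⟨a, d, e, ha, hd, he, hade⟩ :=
    ((hψ.isCharacter.star).mul hϑ).classInner_mul_apply_one_le hχ
  obtain ⟨a', d', e', ha', hd', he', hade'⟩ :=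
    ((hχ.isCharacter.star).mul hϑ).classInner_mul_apply_one_le hψ
  obtain ⟨t, ht⟩ : ∃ t : ℕ, ϑ 1 = t := by
    obtain ⟨V, _, _, _, ρ, rfl⟩ := hϑ
    exact ⟨Module.finrank ℂ V, ρ.char_one⟩
  -- identify: `[χψ, ϑ] = a = a'`, `e = d' t`, `e' = d t`
  have h1 : classInner (χ * ψ) ϑ = a := by
    rw [classInner_mul_left_eq_classInner_star_mul χ hψ.isCharacter ϑ, classInner_comm, ha]
  have h2 : classInner (χ * ψ) ϑ = a' := by
    rw [mul_comm, classInner_mul_left_eq_classInner_star_mul ψ hχ.isCharacter ϑ, classInner_comm,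
      ha']
  have haa : a' = a := by
    have h := h1.symm.trans h2
    exact_mod_cast h.symm
  have hee : e = d' * t := by
    have h := he
    rw [Pi.mul_apply, Pi.star_apply, hd', ht, Complex.star_def, Complex.conj_natCast] at h
    exact_mod_cast h.symm
  have hee' : e' = d * t := by
    have h := he'
    rw [Pi.mul_apply, Pi.star_apply, hd, ht, Complex.star_def, Complex.conj_natCast] at h
    exact_mod_cast h.symm
  refine ⟨a, t, h1, ht, ?_⟩
  rw [haa] at hade'
  rw [hee] at hade
  rw [hee'] at hade'
  -- `d, d' > 0`
  have hd0 : 0 < d := by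
    obtain ⟨n, hn, hn1⟩ := hχ.exists_apply_one
    have : n = d := by have := hn1.symm.trans hd; exact_mod_cast this
    exact this ▸ pos_of_mem_charDegrees hn
  have hd0' : 0 < d' := by
    obtain ⟨n, hn, hn1⟩ := hψ.exists_apply_one
    have : n = d' := by have := hn1.symm.trans hd'; exact_mod_cast this
    exact this ▸ pos_of_mem_charDegrees hn
  rcases le_total d' d with h | h
  · -- `a d ≤ d' t ≤ d t`
    have : a * d ≤ t * d := by nlinarith
    exact Nat.le_of_mul_le_mul_right this hd0
  · have : a * d' ≤ t * d' := by nlinarith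
    exact Nat.le_of_mul_le_mul_right this hd0'

/-- **Isaacs, Problem 4.12: "Let `χ, ψ, ϑ ∈ Irr(G)`. Show that `[χψ, ϑ] ≤ ϑ(1)`."** (Real-part
form; `[χψ, ϑ]` and `ϑ(1)` are natural numbers.) [cite: Isaacs1976, Problem 4.12] -/
theorem IsIrrChar.re_classInner_mul_le_re_apply_one {χ ψ ϑ : G → ℂ} (hχ : IsIrrChar G χ)
    (hψ : IsIrrChar G ψ) (hϑ : IsIrrChar G ϑ) : (classInner (χ * ψ) ϑ).re ≤ (ϑ 1).re := by
  obtain ⟨a, t, ha, ht, hat⟩ := classInner_mul_le_apply_one hχ hψ hϑ.isCharacter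
  rw [ha, ht, Complex.natCast_re, Complex.natCast_re]
  exact_mod_cast hat

end Literature.RepresentationTheory.FiniteGroups

end
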